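import Summits.Ventures.PercRepro.Night2LocalCover
import Summits.Ventures.PercRepro.Night2LocalWeights

/-!
# PercRepro — the dyadic («2-adic») weights of a member and their row sums (night-2, gen 7)

The line case (C1) of the paper proof of `ShadowHall M 4 2` (`proofs/NIGHT-2-local.md` §7) is a fractional
matching in which a member `B` gives weight `c · 2^{-|S ∖ B|}` to every shadow set `S` of which it is the EXACT
trace, `S ∩ cl B = B`.  This file is the `𝒜`-independent part of that matching, at every `q`:

* `union_mem_shadowAt`: `B ∪ Y` is a shadow set with closure `G` for every nonempty `Y ⊆ G ∖ cl B`;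
* `dyadicWeight M G B S = 2^{-|S ∖ B|}` if `B ⊆ S` and `S ∩ cl B = B`, else `0`;
* **`sum_dyadicWeight`**: `Σ_{S ∈ shadowAt 𝒜 G} dyadicWeight B S = (3/2)^{|G ∖ cl B|} − 1` for a member `B` of `𝒜`
  inside `G` — the exact traces are the sets `B ∪ Y`, `∅ ≠ Y ⊆ G ∖ cl B`, and `Σ_{Y ⊆ Z} 2^{-|Y|} = (3/2)^{|Z|}`;
* the constants `dyadicConst m = (4/3)·(m/(m+2)) / ((3/2)^m − 1)` of the line case: `dyadicConst 1 = 8/9`,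
  `dyadicConst m ≤ 8/15` for `m ≥ 2`.
-/

namespace PercRepro.Shadow

open Finset PerFlat ThmH

variable {α : Type*} [DecidableEq α] {M : Matroid α} [M.Finite]

/-! ## Exact traces are shadow sets -/

/-- `B ∪ Y` is a shadow set with closure `G` for every nonempty `Y ⊆ G ∖ cl B`. -/
theorem union_mem_shadowAt {q : ℕ} {𝒜 : Finset (Finset α)} (h𝒜 : 𝒜 ⊆ Uq M (q + 2) q) {G : Finset α}
    (hG : G ∈ flatsQ M (q + 1)) {B : Finset α} (hB : B ∈ membersIn M 𝒜 G) {Y : Finset α}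
    (hY : Y ⊆ G \ clF M B) (hne : Y.Nonempty) : B ∪ Y ∈ shadowAt M (q + 2) q 𝒜 G := by
  obtain ⟨z, hz⟩ := hne
  have hzG : z ∈ G \ clF M B := hY hz
  have hBU : B ∈ Uq M (q + 2) q := h𝒜 (mem_membersIn.1 hB).1
  have hBG : clF M B ⊆ G := (mem_membersIn.1 hB).2
  have hGg : G ⊆ gr M := (mem_flatsQ.1 hG).1
  have hins := insert_mem_shadowAt h𝒜 hG hB hzG
  rw [mem_shadowAt] at hins ⊢
  have hsub : insert z B ⊆ B ∪ Y := by
    intro x hx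
    rw [Finset.mem_insert] at hx
    rcases hx with rfl | hx
    · exact Finset.mem_union_right _ hz
    · exact Finset.mem_union_left _ hx
  have hsubG : B ∪ Y ⊆ G := by
    intro x hx
    rw [Finset.mem_union] at hx
    rcases hx with hx | hx
    · exact hBG (subset_clF hBU hx)
    · exact (Finset.mem_sdiff.1 (hY hx)).1
  have hr1 : M.eRk ((insert z B : Finset α) : Set α) = ((q + 1 : ℕ) : ℕ∞) :=
    eRk_eq_of_mem_Yq_diag (shadow_subset_Yq _ hins.1)
  have hr : M.eRk ((B ∪ Y : Finset α) : Set α) = ((q + 1 : ℕ) : ℕ∞) := by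
    apply le_antisymm
    · rw [← (mem_flatsQ.1 hG).2.2]
      exact M.eRk_mono (by exact_mod_cast hsubG)
    · rw [← hr1]
      exact M.eRk_mono (by exact_mod_cast hsub)
  have hY' : B ∪ Y ∈ Yq M (q + 2) q := by
    unfold Yq
    rw [Finset.mem_filter, Finset.mem_powerset, hr]
    refine ⟨hsubG.trans hGg, ?_, ?_⟩
    · exact_mod_cast Nat.lt_succ_self q
    · exact_mod_cast Nat.lt_succ_self (q + 1)
  refine ⟨?_, ?_⟩
  · rw [mem_shadow]
    exact ⟨hY', B, (mem_membersIn.1 hB).1, Finset.subset_union_left⟩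
  · have hclsub : clF M (B ∪ Y) ⊆ G := by
      rw [← Finset.coe_subset, coe_clF]
      exact (M.closure_subset_closure (by exact_mod_cast hsubG)).trans (mem_flatsQ.1 hG).2.1.closure.subset
    exact flat_eq_of_subset_of_eRk_eq hG (by rw [coe_clF]; exact M.isFlat_closure _) hclsub
      (by rw [coe_clF, M.eRk_closure_eq]; exact hr)

/-- A shadow set with closure `G` lies in `G`. -/
theorem subset_of_mem_shadowAt {p q : ℕ} {𝒜 : Finset (Finset α)} {G S : Finset α}
    (hS : S ∈ shadowAt M p q 𝒜 G) : S ⊆ G := by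
  rw [mem_shadowAt] at hS
  have hSg : S ⊆ gr M := by
    have hY := shadow_subset_Yq _ hS.1
    unfold Yq at hY
    rw [Finset.mem_filter, Finset.mem_powerset] at hY
    exact hY.1
  rw [← hS.2]
  exact subset_clF_of_subset_gr hSg

/-! ## The dyadic weights -/

open scoped Classical in
/-- The dyadic weight of `B` at `S`: `2^{-|S ∖ B|}` if `S` is an exact trace of `B` (`B ⊆ S`, `S ∩ cl B = B`),
else `0`. -/
noncomputable def dyadicWeight (M : Matroid α) [M.Finite] (B S : Finset α) : ℚ :=
  if B ⊆ S ∧ S ∩ clF M B = B then (1 / 2 : ℚ) ^ (S \ B).card else 0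

omit [DecidableEq α] in
/-- `Σ_{Y ⊆ Z} (1/2)^{|Y|} = (3/2)^{|Z|}`. -/
theorem sum_powerset_half_pow (Z : Finset α) :
    ∑ Y ∈ Z.powerset, (1 / 2 : ℚ) ^ Y.card = (3 / 2 : ℚ) ^ Z.card := by
  have h := Finset.sum_pow_mul_eq_add_pow (1 / 2 : ℚ) 1 Z
  simp only [one_pow, mul_one] at h
  rw [h]
  norm_num

/-- `Σ_{∅ ≠ Y ⊆ Z} (1/2)^{|Y|} = (3/2)^{|Z|} − 1`. -/
theorem sum_powerset_erase_half_pow (Z : Finset α) :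
    ∑ Y ∈ Z.powerset.erase ∅, (1 / 2 : ℚ) ^ Y.card = (3 / 2 : ℚ) ^ Z.card - 1 := by
  have hmem : (∅ : Finset α) ∈ Z.powerset := Finset.mem_powerset.2 (Finset.empty_subset _)
  have h := Finset.add_sum_erase Z.powerset (fun Y => (1 / 2 : ℚ) ^ Y.card) hmem
  rw [sum_powerset_half_pow] at h
  simp only [Finset.card_empty, pow_zero] at h
  linarith

open scoped Classical in
/-- The exact traces of a member `B` among the shadow sets with closure `G` are exactly the sets `B ∪ Y`,
`∅ ≠ Y ⊆ G ∖ cl B`. -/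
theorem filter_exact_eq_image {q : ℕ} {𝒜 : Finset (Finset α)} (h𝒜 : 𝒜 ⊆ Uq M (q + 2) q) {G : Finset α}
    (hG : G ∈ flatsQ M (q + 1)) {B : Finset α} (hB : B ∈ membersIn M 𝒜 G) :
    (shadowAt M (q + 2) q 𝒜 G).filter (fun S => B ⊆ S ∧ S ∩ clF M B = B) =
      ((G \ clF M B).powerset.erase ∅).image (fun Y => B ∪ Y) := by
  have hBU : B ∈ Uq M (q + 2) q := h𝒜 (mem_membersIn.1 hB).1
  have hBF : B ⊆ clF M B := subset_clF hBU
  ext S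
  rw [Finset.mem_filter, Finset.mem_image]
  constructor
  · rintro ⟨hS, hBS, hSB⟩
    refine ⟨S \ B, ?_, ?_⟩
    · rw [Finset.mem_erase, Finset.mem_powerset]
      refine ⟨?_, ?_⟩
      · intro hempty
        have hSeq : S = B := by
          rw [Finset.sdiff_eq_empty_iff_subset] at hempty
          exact le_antisymm hempty hBS
        have hr := eRk_eq_of_mem_Yq_diag (shadow_subset_Yq _ (mem_shadowAt.1 hS).1)
        rw [hSeq, (mem_Uq.1 hBU).2.1] at hr
        have : q = q + 1 := by exact_mod_cast hr
        omega
      · intro x hx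
        rw [Finset.mem_sdiff] at hx ⊢
        refine ⟨subset_of_mem_shadowAt hS hx.1, ?_⟩
        intro hxF
        have : x ∈ S ∩ clF M B := Finset.mem_inter.2 ⟨hx.1, hxF⟩
        rw [hSB] at this
        exact hx.2 this
    · exact Finset.union_sdiff_of_subset hBS
  · rintro ⟨Y, hY, rfl⟩
    rw [Finset.mem_erase, Finset.mem_powerset] at hY
    have hne : Y.Nonempty := Finset.nonempty_iff_ne_empty.2 hY.1
    refine ⟨union_mem_shadowAt h𝒜 hG hB hY.2 hne, Finset.subset_union_left, ?_⟩
    ext x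
    rw [Finset.mem_inter, Finset.mem_union]
    constructor
    · rintro ⟨h | h, hxF⟩
      · exact h
      · exact absurd hxF (Finset.mem_sdiff.1 (hY.2 h)).2
    · intro hx
      exact ⟨Or.inl hx, hBF hx⟩

open scoped Classical in
/-- **The row sum of the dyadic weights**: `Σ_{S ∈ shadowAt 𝒜 G} dyadicWeight B S = (3/2)^{|G ∖ cl B|} − 1`. -/
theorem sum_dyadicWeight {q : ℕ} {𝒜 : Finset (Finset α)} (h𝒜 : 𝒜 ⊆ Uq M (q + 2) q) {G : Finset α}
    (hG : G ∈ flatsQ M (q + 1)) {B : Finset α} (hB : B ∈ membersIn M 𝒜 G) :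
    ∑ S ∈ shadowAt M (q + 2) q 𝒜 G, dyadicWeight M B S = (3 / 2 : ℚ) ^ (G \ clF M B).card - 1 := by
  have hBU : B ∈ Uq M (q + 2) q := h𝒜 (mem_membersIn.1 hB).1
  have hBF : B ⊆ clF M B := subset_clF hBU
  unfold dyadicWeight
  rw [← Finset.sum_filter, filter_exact_eq_image h𝒜 hG hB, Finset.sum_image]
  · rw [← sum_powerset_erase_half_pow]
    apply Finset.sum_congr rfl
    intro Y hY
    rw [Finset.mem_erase, Finset.mem_powerset] at hY
    congr 1
    rw [Finset.union_sdiff_left]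
    congr 1
    rw [Finset.sdiff_eq_self_iff_disjoint, Finset.disjoint_left]
    intro x hx hxB
    exact (Finset.mem_sdiff.1 (hY.2 hx)).2 (hBF hxB)
  · intro Y hY Y' hY' h
    rw [Finset.mem_coe, Finset.mem_erase, Finset.mem_powerset] at hY hY'
    have h' : B ∪ Y = B ∪ Y' := h
    have hdisj : ∀ {W : Finset α}, W ⊆ G \ clF M B → (B ∪ W) \ B = W := by
      intro W hW
      rw [Finset.union_sdiff_left, Finset.sdiff_eq_self_iff_disjoint, Finset.disjoint_left]
      intro x hx hxB
      exact (Finset.mem_sdiff.1 (hW hx)).2 (hBF hxB)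
    rw [← hdisj hY.2, ← hdisj hY'.2, h']

/-! ## The constants of the line case -/

/-- The constant `c(m) = (4/3)·(m/(m+2)) / ((3/2)^m − 1)` of the line case. -/
noncomputable def dyadicConst (m : ℕ) : ℚ :=
  (4 / 3 : ℚ) * ((m : ℚ) / ((m : ℚ) + 2)) / ((3 / 2 : ℚ) ^ m - 1)

omit [DecidableEq α] in
/-- `(3/2)^m − 1 > 0` for `m ≥ 1`. -/
theorem three_half_pow_sub_one_pos {m : ℕ} (hm : 1 ≤ m) : (0 : ℚ) < (3 / 2 : ℚ) ^ m - 1 := by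
  have : (1 : ℚ) < (3 / 2 : ℚ) ^ m := one_lt_pow₀ (by norm_num) (by omega)
  linarith

omit [DecidableEq α] in
/-- `c(m) · ((3/2)^m − 1) = (4/3)·(m/(m+2))`. -/
theorem dyadicConst_mul {m : ℕ} (hm : 1 ≤ m) :
    dyadicConst m * ((3 / 2 : ℚ) ^ m - 1) = (4 / 3 : ℚ) * ((m : ℚ) / ((m : ℚ) + 2)) := by
  unfold dyadicConst
  rw [div_mul_cancel₀ _ (three_half_pow_sub_one_pos hm).ne']

omit [DecidableEq α] in
/-- `c(1) = 8/9`. -/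
theorem dyadicConst_one : dyadicConst 1 = 8 / 9 := by
  unfold dyadicConst
  norm_num

omit [DecidableEq α] in
/-- `(7m + 4)·2^m ≤ (2m + 4)·3^m` for `m ≥ 2`. -/
theorem seven_mul_two_pow_le (m : ℕ) (hm : 2 ≤ m) : (7 * m + 4) * 2 ^ m ≤ (2 * m + 4) * 3 ^ m := by
  induction m with
  | zero => omega
  | succ n ih =>
    rcases Nat.lt_or_ge n 2 with h | h
    · interval_cases n
      · omega
      · norm_num
    · have ih' := ih h
      have h2 : 2 ^ n ≤ 3 ^ n := Nat.pow_le_pow_left (by norm_num) n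
      have h3 : 14 * 2 ^ n ≤ (2 * n + 10) * 3 ^ n :=
        calc 14 * 2 ^ n ≤ 14 * 3 ^ n := Nat.mul_le_mul_left _ h2
          _ ≤ (2 * n + 10) * 3 ^ n := Nat.mul_le_mul_right _ (by omega)
      rw [pow_succ, pow_succ]
      nlinarith [ih', h3]

omit [DecidableEq α] in
/-- `c(m) ≤ 8/15` for `m ≥ 2`. -/
theorem dyadicConst_le {m : ℕ} (hm : 2 ≤ m) : dyadicConst m ≤ 8 / 15 := by
  unfold dyadicConst
  have hpos := three_half_pow_sub_one_pos (by omega : 1 ≤ m)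
  have hm2 : (0 : ℚ) < (m : ℚ) + 2 := by positivity
  have hm2' : (m : ℚ) + 2 ≠ 0 := hm2.ne'
  have h2pos : (0 : ℚ) < (2 : ℚ) ^ m := by positivity
  have h2ne : (2 : ℚ) ^ m ≠ 0 := h2pos.ne'
  have hq : ((7 * m + 4 : ℕ) : ℚ) * (2 : ℚ) ^ m ≤ ((2 * m + 4 : ℕ) : ℚ) * (3 : ℚ) ^ m := by
    exact_mod_cast seven_mul_two_pow_le m hm
  push_cast at hq
  have h32 : (3 / 2 : ℚ) ^ m - 1 = ((3 : ℚ) ^ m - (2 : ℚ) ^ m) / (2 : ℚ) ^ m := by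
    rw [div_pow, sub_div, div_self h2ne]
  have key : (4 / 3 : ℚ) * ((m : ℚ) / ((m : ℚ) + 2)) ≤
      (8 / 15 : ℚ) * (((3 : ℚ) ^ m - (2 : ℚ) ^ m) / (2 : ℚ) ^ m) := by
    rw [show (4 / 3 : ℚ) * ((m : ℚ) / ((m : ℚ) + 2)) = (4 * (m : ℚ)) / (3 * ((m : ℚ) + 2)) by
          field_simp,
        show (8 / 15 : ℚ) * (((3 : ℚ) ^ m - (2 : ℚ) ^ m) / (2 : ℚ) ^ m) =
          (8 * ((3 : ℚ) ^ m - (2 : ℚ) ^ m)) / (15 * (2 : ℚ) ^ m) by field_simp]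
    rw [div_le_div_iff₀ (by positivity) (by positivity)]
    nlinarith [hq]
  rw [div_le_iff₀ hpos, h32]
  exact key

end PercRepro.Shadow
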